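import Literature.Geometry.Lorentzian.IPlusRegular
import Literature.Geometry.Lorentzian.KillingOnIntegralCurveUnique
import Literature.Geometry.Lorentzian.CoordinateFrames
import Literature.Geometry.Lorentzian.FlatParallelFrame
import HarnessLib

/-!
# Crux `HawkingExtensionIsKerr` (stmt-FinalStateConjecture-17840), line `SketchIdeator2` —
# programme SEC, brick SEC-3a: `K`-lines on the degenerate horizon are null geodesic segments

Helper file of the line lead (c7), registered sub-goal `stub_sec_nullLine` (the local half of
SEC-3, "the integral curves of the collar Killing field inside `𝓔⁺` are generators").

Setting: a stationary asymptotically flat black hole `𝓑` (`StationaryAFBlackHole`), an open set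
`U ⊇ 𝓔⁺ = 𝓑.horizon` and a Killing field `K` of `g = 𝓑.metric` on `U` (`IsKillingFieldOn`) which on
`𝓔⁺` is nowhere zero, null (`g(K, K) = 0`), DEGENERATE (`∇_K K = 0`) and of constant time
orientation (`g(T, K) < 0` on all of `𝓔⁺` or `g(T, K) > 0` on all of `𝓔⁺`, `T` the orienting
field).  We prove:

* `isGeodesicOn_of_isMIntegralCurveOn` — an integral curve `γ₀` of `K` on `(a, b)` lying in `𝓔⁺`
  is an (affinely parametrised) geodesic of the Levi-Civita connection on `(a, b)`: its velocity
  is `K ∘ γ₀` (Mathlib's `IsMIntegralCurveOn`), so its tangent lift agrees near every parameter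
  with the lift of the restriction `K ∘ γ₀`, which is differentiable (chain rule), and its
  acceleration is `D(γ₀')/dt = D(K ∘ γ₀)/dt = ∇_{γ₀'} K = (∇_K K)(γ₀ t) = 0` (locality of `D/dt` in
  the field, `covariantDerivAlong_congr_field`; restriction rule `covariantDerivAlong_comp_holds`,
  O'Neill 1983, Ch. 3, Prop. 3.18 (3); degeneracy);
* `stub_sec_nullLine` — the registered statement: with the sign `ε = ±1` chosen ONCE from the
  time-orientation dichotomy (`ε = 1` if `g(T, K) < 0` on `𝓔⁺`, `ε = -1` otherwise), every such
  `γ₀` reparametrises to the future-directed null geodesic segment `t ↦ γ₀ (ε t)` in `𝓔⁺`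
  (`LorentzianMetric.IsNullGeodesicIn`) on `{t | ε t ∈ (a, b)}`, with velocity `ε K`: linear
  reparametrisations of geodesics are geodesics (`IsGeodesicOn.comp_affine_holds`, O'Neill 1983,
  Ch. 3, Lemma 3.21), `g(εK, εK) = ε² g(K, K) = 0`, `ε K ≠ 0`, `g(T, ε K) = ε g(T, K) < 0`.

The three private reparametrisation lemmas (`velocity_comp_mul'`, `isGeodesicOn_comp_mul'`,
`ordConnected_preimage_mul'`) are adapted from `Literature/Geometry/Lorentzian/NullInfinityConstSmul.lean`
(not imported: its import closure is ninety files heavier than this file's).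
-/

noncomputable section

set_option linter.dupNamespace false

namespace Summit.FinalStateConjecture.FinalStateConjecture.Theorems.HawkingExtensionIsKerr.SketchIdeator2

open Set Filter Bundle Function Literature.Geometry.Lorentzian
open scoped Manifold ContDiff Topology

/-! ### Linear reparametrisation `t ↦ γ (a t)` (generic) -/

section Reparam

variable {E : Type*} [NormedAddCommGroup E] [NormedSpace ℝ E] {H : Type*} [TopologicalSpace H]
  {I : ModelWithCorners ℝ E H} {M : Type*} [TopologicalSpace M] [ChartedSpace H M]

/-- Velocity of a linearly reparametrised curve: `(γ(a ·))'(t) = a γ'(a t)` (O'Neill 1983, Ch. 3,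
proof of Lemma 3.21; the tree's `velocity_comp_affine` with `b = 0`). -/
-- adapted from `velocity_comp_mul`, Literature/Geometry/Lorentzian/NullInfinityConstSmul.lean
private theorem velocity_comp_mul' (γ : ℝ → M) (a t : ℝ) :
    velocity I (fun t ↦ γ (a * t)) t = a • velocity I γ (a * t) := by
  have h := velocity_comp_affine (I := I) γ a 0 t
  have e : (fun t ↦ γ (a * t + 0)) = fun t ↦ γ (a * t) := by
    funext u
    rw [add_zero]
  rw [e, add_zero] at h
  exact h

/-- A linear reparametrisation `t ↦ γ (a t)` of a geodesic on `s` is a geodesic on `(a ·)⁻¹' s`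
(O'Neill 1983, Ch. 3, Def. 3.20 and Lemma 3.21; the tree's `IsGeodesicOn.comp_affine_holds` with
`b = 0`). -/
-- adapted from `IsGeodesicOn.comp_mul`, Literature/Geometry/Lorentzian/NullInfinityConstSmul.lean
private theorem isGeodesicOn_comp_mul' [IsManifold I ∞ M] [FiniteDimensional ℝ E]
    {cov : CovariantDerivative I E (TangentSpace I : M → Type _)} {γ : ℝ → M} {s : Set ℝ}
    (h : IsGeodesicOn cov γ s) (a : ℝ) :
    IsGeodesicOn cov (fun t ↦ γ (a * t)) ((fun t ↦ a * t) ⁻¹' s) := by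
  simpa using IsGeodesicOn.comp_affine_holds h a 0

/-- The preimage of an order-connected set of reals under `t ↦ a t` is order connected. -/
-- adapted from `ordConnected_preimage_mul`, Literature/Geometry/Lorentzian/NullInfinityConstSmul.lean
private theorem ordConnected_preimage_mul' {s : Set ℝ} (hs : s.OrdConnected) (a : ℝ) :
    ((fun t ↦ a * t) ⁻¹' s).OrdConnected := by
  rcases le_or_gt 0 a with ha | ha
  · exact hs.preimage_mono fun x y hxy ↦ mul_le_mul_of_nonneg_left hxy ha
  · exact hs.preimage_anti fun x y hxy ↦ mul_le_mul_of_nonpos_left hxy ha.le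

end Reparam

/-! ### Integral curves of `K` in the degenerate horizon are geodesics -/

/-- An integral curve of `K` on the open interval `(a, b)` has the manifold derivative `1 ↦ K (γ₀ t)`
at every `t ∈ (a, b)` (Mathlib's `IsMIntegralCurveOn` records the derivative within `(a, b)`, a
neighbourhood of `t`). -/
private theorem hasMFDerivAt_of_isMIntegralCurveOn_Ioo {𝓑 : StationaryAFBlackHole.{0}}
    {K : Π x : 𝓑.carrier, TangentSpace (𝓡 4) x} {γ₀ : ℝ → 𝓑.carrier} {a b : ℝ}
    (hγ : IsMIntegralCurveOn γ₀ K (Ioo a b)) {t : ℝ} (ht : t ∈ Ioo a b) :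
    HasMFDerivAt 𝓘(ℝ, ℝ) (𝓡 4) γ₀ t ((1 : ℝ →L[ℝ] ℝ).smulRight (K (γ₀ t))) :=
  (hγ t ht).hasMFDerivAt (isOpen_Ioo.mem_nhds ht)

/-- The velocity of an integral curve of `K` on `(a, b)` is `K ∘ γ₀` there (O'Neill 1983, Ch. 1,
Def. 1.46; compare the tree's `velocity_eq_of_isMIntegralCurve` for global integral curves). -/
private theorem velocity_eq_of_isMIntegralCurveOn_Ioo {𝓑 : StationaryAFBlackHole.{0}}
    {K : Π x : 𝓑.carrier, TangentSpace (𝓡 4) x} {γ₀ : ℝ → 𝓑.carrier} {a b : ℝ}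
    (hγ : IsMIntegralCurveOn γ₀ K (Ioo a b)) {t : ℝ} (ht : t ∈ Ioo a b) :
    velocity (𝓡 4) γ₀ t = K (γ₀ t) := by
  rw [velocity, (hasMFDerivAt_of_isMIntegralCurveOn_Ioo hγ ht).mfderiv]
  exact one_smul ℝ _

/-- **Integral curves of a Killing field in its degenerate set are geodesics.**  Let `K` be a
Killing field on an open `U ⊇ 𝓔⁺` with `∇_K K = 0` on `𝓔⁺`, and `γ₀` an integral curve of `K` on
`(a, b)` lying in `𝓔⁺`.  Then `γ₀` is a geodesic of the Levi-Civita connection on `(a, b)`: near each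
`t₀ ∈ (a, b)` the velocity field of `γ₀` IS `K ∘ γ₀`, so (i) the tangent lift `t ↦ (γ₀ t, γ₀' t)` agrees
near `t₀` with the lift of `K ∘ γ₀`, differentiable at `t₀` by the chain rule
(`mdifferentiableAt_lift_comp`), and (ii) `D(γ₀')/dt (t₀) = D(K ∘ γ₀)/dt (t₀)` (locality,
`covariantDerivAlong_congr_field`) `= ∇_{γ₀'(t₀)} K` (`covariantDerivAlong_comp_holds`, O'Neill 1983,
Ch. 3, Prop. 3.18 (3)) `= (∇_K K)(γ₀ t₀) = 0`.  Heusler 1996, §6 (on a Killing horizon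
`∇_K K = κ K`; `κ = 0` is the degenerate case, where the Killing parameter is affine). -/
theorem isGeodesicOn_of_isMIntegralCurveOn (𝓑 : StationaryAFBlackHole.{0}) [𝓑.metric.HasLeviCivita]
    {U : Set 𝓑.carrier} {K : Π x : 𝓑.carrier, TangentSpace (𝓡 4) x} (hU : IsOpen U)
    (hHU : 𝓑.horizon ⊆ U) (hK : 𝓑.metric.toPseudoRiemannianMetric.IsKillingFieldOn K U)
    (hdeg : ∀ p ∈ 𝓑.horizon, 𝓑.metric.leviCivita K p (K p) = 0) {γ₀ : ℝ → 𝓑.carrier} {a b : ℝ}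
    (hγ : IsMIntegralCurveOn γ₀ K (Ioo a b)) (hγH : ∀ t ∈ Ioo a b, γ₀ t ∈ 𝓑.horizon) :
    IsGeodesicOn 𝓑.metric.leviCivita γ₀ (Ioo a b) := by
  have hev : ∀ t₀ ∈ Ioo a b, ∀ᶠ t in 𝓝 t₀, velocity (𝓡 4) γ₀ t = K (γ₀ t) := fun t₀ ht₀ ↦ by
    filter_upwards [isOpen_Ioo.mem_nhds ht₀] with t ht
    exact velocity_eq_of_isMIntegralCurveOn_Ioo hγ ht
  have hγd : ∀ t₀ ∈ Ioo a b, MDifferentiableAt 𝓘(ℝ, ℝ) (𝓡 4) γ₀ t₀ := fun t₀ ht₀ ↦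
    (hasMFDerivAt_of_isMIntegralCurveOn_Ioo hγ ht₀).mdifferentiableAt
  have hKd : ∀ t₀ ∈ Ioo a b, MDifferentiableAt (𝓡 4) ((𝓡 4).prod 𝓘(ℝ, E4))
      (fun x ↦ (TotalSpace.mk' E4 x (K x) : TangentBundle (𝓡 4) 𝓑.carrier)) (γ₀ t₀) :=
    fun t₀ ht₀ ↦ hK.mdifferentiableAt hU (hHU (hγH t₀ ht₀))
  refine ⟨fun t₀ ht₀ ↦ ?_, fun t₀ ht₀ ↦ ?_⟩
  · refine (mdifferentiableAt_lift_comp (hKd t₀ ht₀) (hγd t₀ ht₀)).congr_of_eventuallyEq ?_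
    filter_upwards [hev t₀ ht₀] with t ht
    exact TotalSpace.ext rfl (heq_of_eq ht)
  · rw [covariantDerivAlong_congr_field 𝓑.metric.leviCivita (hev t₀ ht₀),
      covariantDerivAlong_comp_holds 𝓑.metric.leviCivita (hγd t₀ ht₀) (hKd t₀ ht₀),
      velocity_eq_of_isMIntegralCurveOn_Ioo hγ ht₀]
    exact hdeg _ (hγH t₀ ht₀)

/-! ### The registered statement -/

/-- **SEC-3a (registered sub-goal `stub_sec_nullLine`): `K`-lines on the degenerate horizon are
future-directed null geodesic segments after the sign fix `ε = ±1`.**  For a Killing field `K` on an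
open `U ⊇ 𝓔⁺`, nowhere zero, null and degenerate (`∇_K K = 0`) on `𝓔⁺`, and everywhere future- or
everywhere past-directed on `𝓔⁺`, there is `ε ∈ {1, -1}` (namely `ε = 1` in the first case,
`ε = -1` in the second) such that for every integral curve `γ₀` of `K` on `(a, b)` lying in `𝓔⁺`
the curve `t ↦ γ₀ (ε t)` is a future-directed null geodesic segment in `𝓔⁺` on `{t | ε t ∈ (a, b)}`
(`LorentzianMetric.IsNullGeodesicIn`: order-connected parameter set, geodesic, null future-directed
velocity, values in `𝓔⁺`) with velocity `ε K (γ₀ (ε t))`.  Proof: `γ₀` is a geodesic on `(a, b)`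
with velocity `K ∘ γ₀` (`isGeodesicOn_of_isMIntegralCurveOn`); linear reparametrisations of
geodesics are geodesics with velocity scaled by `ε` (O'Neill 1983, Ch. 3, Lemma 3.21); and at
`p = γ₀ (ε t) ∈ 𝓔⁺`, `g(εK, εK) = ε² g(K, K) = 0`, `ε K ≠ 0`, `g(T, ε K) = ε g(T, K) < 0` by the
choice of `ε`.  Heusler 1996, §6; Chruściel–Costa 2008, §4.1 (generators of `𝓔⁺`). -/
theorem stub_sec_nullLine : ∀ (𝓑 : StationaryAFBlackHole.{0}) [𝓑.metric.HasLeviCivita] (U : Set 𝓑.carrier) (K : Π x : 𝓑.carrier, TangentSpace (𝓡 4) x), IsOpen U → 𝓑.horizon ⊆ U → 𝓑.metric.toPseudoRiemannianMetric.IsKillingFieldOn K U → (∀ p ∈ 𝓑.horizon, K p ≠ 0) → (∀ p ∈ 𝓑.horizon, 𝓑.metric.val p (K p) (K p) = 0) → ((∀ p ∈ 𝓑.horizon, 𝓑.metric.val p (𝓑.timeOrientation.vectorField p) (K p) < 0) ∨ (∀ p ∈ 𝓑.horizon, 0 < 𝓑.metric.val p (𝓑.timeOrientation.vectorField p) (K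 p))) → (∀ p ∈ 𝓑.horizon, 𝓑.metric.leviCivita K p (K p) = 0) → ∃ ε : ℝ, (ε = 1 ∨ ε = -1) ∧ ∀ (γ₀ : ℝ → 𝓑.carrier) (a b : ℝ), IsMIntegralCurveOn γ₀ K (Ioo a b) → (∀ t ∈ Ioo a b, γ₀ t ∈ 𝓑.horizon) → 𝓑.metric.IsNullGeodesicIn 𝓑.timeOrientation 𝓑.horizon (fun t : ℝ ↦ γ₀ (ε * t)) {t : ℝ | ε * t ∈ Ioo a b} ∧ ∀ t : ℝ, ε * t ∈ Ioo a b → velocity (𝓡 4) (fun t : ℝ ↦ γ₀ (ε * t)) t = ε • K (γ₀ (ε * t)) := by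
  intro 𝓑 _ U K hU hHU hK hK0 hKnull hdich hdeg
  -- the sign `ε`, fixed once: `ε g(T, K) < 0` on the horizon
  obtain ⟨ε, hε, hεK⟩ : ∃ ε : ℝ, (ε = 1 ∨ ε = -1) ∧
      ∀ p ∈ 𝓑.horizon, ε * 𝓑.metric.val p (𝓑.timeOrientation.vectorField p) (K p) < 0 := by
    rcases hdich with h | h
    · exact ⟨1, Or.inl rfl, fun p hp ↦ by linarith [h p hp]⟩
    · exact ⟨-1, Or.inr rfl, fun p hp ↦ by linarith [h p hp]⟩
  have hε0 : ε ≠ 0 := by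
    rcases hε with rfl | rfl <;> norm_num
  refine ⟨ε, hε, fun γ₀ a b hγ hγH ↦ ?_⟩
  have hgeo : IsGeodesicOn 𝓑.metric.leviCivita γ₀ (Ioo a b) :=
    isGeodesicOn_of_isMIntegralCurveOn 𝓑 hU hHU hK hdeg hγ hγH
  have hvel : ∀ t : ℝ, ε * t ∈ Ioo a b →
      velocity (𝓡 4) (fun t : ℝ ↦ γ₀ (ε * t)) t = ε • K (γ₀ (ε * t)) := fun t ht ↦ by
    rw [velocity_comp_mul' γ₀ ε t, velocity_eq_of_isMIntegralCurveOn_Ioo hγ ht]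
  refine ⟨⟨ordConnected_preimage_mul' ordConnected_Ioo ε, isGeodesicOn_comp_mul' hgeo ε,
    fun t ht ↦ ?_, fun t ht ↦ hγH _ ht⟩, hvel⟩
  -- null and future-directed velocity at `t`, `ε t ∈ (a, b)`
  have hp : γ₀ (ε * t) ∈ 𝓑.horizon := hγH _ ht
  have hne : ε • K (γ₀ (ε * t)) ≠ 0 := smul_ne_zero hε0 (hK0 _ hp)
  have hnull : 𝓑.metric.val (γ₀ (ε * t)) (ε • K (γ₀ (ε * t))) (ε • K (γ₀ (ε * t))) = 0 := by
    rw [map_smul, map_smul, _root_.smul_apply, hKnull _ hp, smul_zero, smul_zero]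
  have hfut : 𝓑.metric.val (γ₀ (ε * t)) (𝓑.timeOrientation.vectorField (γ₀ (ε * t)))
      (ε • K (γ₀ (ε * t))) < 0 := by
    rw [map_smul, smul_eq_mul]
    exact hεK _ hp
  rw [hvel t ht]
  exact ⟨⟨hnull, hne⟩, ⟨hnull.le, hne⟩, hfut⟩

end Summit.FinalStateConjecture.FinalStateConjecture.Theorems.HawkingExtensionIsKerr.SketchIdeator2

end
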